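import Mathlib.Analysis.Calculus.LineDeriv.IntegrationByParts
import Mathlib.Analysis.Calculus.FDeriv.Symmetric
import Mathlib.Analysis.InnerProductSpace.Calculus
import Mathlib.Analysis.SpecialFunctions.SmoothTransition
import Mathlib.MeasureTheory.Measure.Haar.InnerProductSpace
import Mathlib.Analysis.InnerProductSpace.PiL2
import HarnessLib

/-!
# Calculus for Carleman-type inequalities on space–time `ℝ × E`

Support file for the first Carleman inequality of Escauriaza–Seregin–Šverák (Seregin 2014,
Appendix A, Prop. 1.2; `FluidPDE/CarlemanFirst`). All functions are **uncurried** space–time fields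
`V : ℝ × E → F` (time first), `E` a finite-dimensional real inner product space, `F` a real inner
product space. We set up

* the directional derivatives `∂ₜV = DV (1, 0)`, `∂ₑV = DV (0, e)`, the dilation derivative
  `(x·∇)V = DV (0, x)`, the spatial Laplacian `ΔₓV = Σᵢ ∂ᵢ∂ᵢV` and `|∇ₓV|² = Σᵢ ‖∂ᵢV‖²`
  (standard orthonormal frame of `E`);
* their smoothness / compact support for smooth compactly supported `V`, and Schwarz's rule;
* **integration by parts on `ℝ × E` without boundary terms**
  (`integral_mul_inner_fderiv_eq`): `∫ w ⟪Φ, ∂ᵥΨ⟫ = -∫ ∂ᵥw ⟪Φ, Ψ⟫ - ∫ w ⟪∂ᵥΦ, Ψ⟫` for `C¹`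
  compactly supported `Φ`, `Ψ` with `Φ` supported in `{t ≥ δ}`, `δ > 0`, and a weight `w` of
  class `C¹` on `{t > δ/2}` only (so that weights singular at `t = 0`, such as `|x|²/t`, are
  admitted) — Mathlib's `integral_bilinear_hasFDerivAt_right_eq_neg_left_of_integrable` on the
  finite-dimensional space `ℝ × E` with its (additive Haar) Lebesgue measure, all products being
  continuous and compactly supported (gluing across the layer `δ/2 < t < δ`,
  `continuous_of_zero_of_lt`, `contDiff_of_zero_of_lt`);
* the consequences used in the `L₂` (Hörmander) method: the square rule
  `2 ∫ w ⟪W, ∂ᵥW⟫ = -∫ ∂ᵥw ‖W‖²`, the dilation identity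
  `2 ∫ w ⟪(x·∇)W, W⟫ = -∫ ((x·∇)w + n w) ‖W‖²`, Green's formula in space
  `∫ g(t) ⟪X, ΔₓV⟫ = -Σᵢ ∫ g(t) ⟪∂ᵢX, ∂ᵢV⟫`, and the three evaluations
  `∫ g ⟪V, ΔₓV⟫ = -∫ g |∇ₓV|²`, `∫ g ⟪∂ₜV, ΔₓV⟫ = ½ ∫ g' |∇ₓV|²`,
  `∫ g ⟪(x·∇)V, ΔₓV⟫ = (n/2 - 1) ∫ g |∇ₓV|²` (Seregin 2014, (A.1.6)).

## References

* G. Seregin, *Lecture notes on regularity theory for the Navier–Stokes equations*, World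
  Scientific 2014, Appendix A.1 (Prop. 1.2, (A.1.2)–(A.1.11)).
* L. Hörmander, *Linear partial differential operators*, Springer 1963, §8 (the `L₂` method of
  Carleman estimates: symmetric/antisymmetric splitting).
-/

noncomputable section

open MeasureTheory Set Function Filter Topology
open scoped InnerProductSpace RealInnerProductSpace

namespace Literature.Analysis.FluidPDE

namespace Carleman

section Operators

variable {E : Type*} [NormedAddCommGroup E] [InnerProductSpace ℝ E]
variable {F : Type*} [NormedAddCommGroup F] [NormedSpace ℝ F]

/-- The time derivative `∂ₜV (t, x) = DV(t, x) (1, 0)` of an uncurried space–time field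
(Seregin 2014, App. A notation). [cite: Seregin2014, App. A.1] -/
def dt (V : ℝ × E → F) (z : ℝ × E) : F :=
  fderiv ℝ V z (1, 0)

/-- The spatial directional derivative `∂ₑV (t, x) = DV(t, x) (0, e)`. [cite: Seregin2014, App. A.1] -/
def dx (e : E) (V : ℝ × E → F) (z : ℝ × E) : F :=
  fderiv ℝ V z (0, e)

/-- The dilation (radial) derivative `(x·∇)V (t, x) = DV(t, x) (0, x)`. [cite: Seregin2014, App. A.1 (A.1.4)] -/
def xdx (V : ℝ × E → F) (z : ℝ × E) : F :=
  fderiv ℝ V z (0, z.2)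

/-- The spatial Laplacian `ΔₓV = Σᵢ ∂ᵢ∂ᵢV` in the standard orthonormal frame of `E`. [cite: Seregin2014, App. A.1] -/
def lap [FiniteDimensional ℝ E] (V : ℝ × E → F) (z : ℝ × E) : F :=
  ∑ i, dx (stdOrthonormalBasis ℝ E i) (dx (stdOrthonormalBasis ℝ E i) V) z

/-- The squared spatial gradient `|∇ₓV|² = Σᵢ ‖∂ᵢV‖²` in the standard orthonormal frame. [cite: Seregin2014, App. A.1] -/
def gradSq [FiniteDimensional ℝ E] (V : ℝ × E → F) (z : ℝ × E) : ℝ :=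
  ∑ i, ‖dx (stdOrthonormalBasis ℝ E i) V z‖ ^ 2

variable {V : ℝ × E → F}

/-- Unfolding `dt`. [folklore] -/
@[simp] theorem dt_apply (V : ℝ × E → F) (z : ℝ × E) : dt V z = fderiv ℝ V z (1, 0) := rfl

/-- Unfolding `dx`. [folklore] -/
@[simp] theorem dx_apply (e : E) (V : ℝ × E → F) (z : ℝ × E) :
    dx e V z = fderiv ℝ V z (0, e) := rfl

/-- Unfolding `xdx`. [folklore] -/
@[simp] theorem xdx_apply (V : ℝ × E → F) (z : ℝ × E) : xdx V z = fderiv ℝ V z (0, z.2) := rfl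

/-- `|∇ₓV|² ≥ 0`. [folklore] -/
theorem gradSq_nonneg [FiniteDimensional ℝ E] (V : ℝ × E → F) (z : ℝ × E) : 0 ≤ gradSq V z :=
  Finset.sum_nonneg fun _ _ => sq_nonneg _

/-! #### Smoothness and support -/

/-- A directional derivative of a smooth field is smooth. [folklore] -/
theorem contDiff_fderiv_apply_const (hV : ContDiff ℝ (⊤ : ℕ∞) V) (w : ℝ × E) :
    ContDiff ℝ (⊤ : ℕ∞) fun z => fderiv ℝ V z w :=
  (hV.fderiv_right (m := (⊤ : ℕ∞)) le_rfl).clm_apply contDiff_const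

/-- `∂ₜ` preserves smoothness. [folklore] -/
theorem contDiff_dt (hV : ContDiff ℝ (⊤ : ℕ∞) V) : ContDiff ℝ (⊤ : ℕ∞) (dt V) :=
  contDiff_fderiv_apply_const hV _

/-- `∂ₑ` preserves smoothness. [folklore] -/
theorem contDiff_dx (hV : ContDiff ℝ (⊤ : ℕ∞) V) (e : E) : ContDiff ℝ (⊤ : ℕ∞) (dx e V) :=
  contDiff_fderiv_apply_const hV _

/-- `(x·∇)` preserves smoothness. [folklore] -/
theorem contDiff_xdx (hV : ContDiff ℝ (⊤ : ℕ∞) V) : ContDiff ℝ (⊤ : ℕ∞) (xdx V) :=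
  (hV.fderiv_right (m := (⊤ : ℕ∞)) le_rfl).clm_apply
    ((contDiff_const (c := (0 : ℝ))).prodMk contDiff_snd)

/-- `Δₓ` preserves smoothness. [folklore] -/
theorem contDiff_lap [FiniteDimensional ℝ E] (hV : ContDiff ℝ (⊤ : ℕ∞) V) :
    ContDiff ℝ (⊤ : ℕ∞) (lap V) := by
  unfold lap
  exact ContDiff.sum fun i _ => contDiff_dx (contDiff_dx hV _) _

/-- Directional derivatives of compactly supported fields are compactly supported. [folklore] -/
theorem hasCompactSupport_fderiv_apply_const (hV : HasCompactSupport V) (w : ℝ × E) :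
    HasCompactSupport fun z => fderiv ℝ V z w :=
  hV.fderiv_apply (𝕜 := ℝ) w

/-- The support of a directional derivative lies in the support of the field. [folklore] -/
theorem tsupport_fderiv_apply_const_subset (V : ℝ × E → F) (w : ℝ × E) :
    tsupport (fun z => fderiv ℝ V z w) ⊆ tsupport V :=
  tsupport_fderiv_apply_subset (𝕜 := ℝ) w

/-- `∂ₜ` preserves compact support. [folklore] -/
theorem hasCompactSupport_dt (hV : HasCompactSupport V) : HasCompactSupport (dt V) :=
  hasCompactSupport_fderiv_apply_const hV _

/-- `∂ₑ` preserves compact support. [folklore] -/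
theorem hasCompactSupport_dx (hV : HasCompactSupport V) (e : E) : HasCompactSupport (dx e V) :=
  hasCompactSupport_fderiv_apply_const hV _

/-- `tsupport ∂ₜV ⊆ tsupport V`. [folklore] -/
theorem tsupport_dt_subset (V : ℝ × E → F) : tsupport (dt V) ⊆ tsupport V :=
  tsupport_fderiv_apply_const_subset V _

/-- `tsupport ∂ₑV ⊆ tsupport V`. [folklore] -/
theorem tsupport_dx_subset (e : E) (V : ℝ × E → F) : tsupport (dx e V) ⊆ tsupport V :=
  tsupport_fderiv_apply_const_subset V _

/-- Off the support all derivative expressions vanish: `DV = 0` there. [folklore] -/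
theorem fderiv_eq_zero_of_notMem_tsupport {z : ℝ × E} (hz : z ∉ tsupport V) : fderiv ℝ V z = 0 :=
  fderiv_of_notMem_tsupport (𝕜 := ℝ) hz

/-- `tsupport (x·∇)V ⊆ tsupport V`. [folklore] -/
theorem tsupport_xdx_subset (V : ℝ × E → F) : tsupport (xdx V) ⊆ tsupport V := by
  refine closure_minimal (fun z hz => ?_) (isClosed_tsupport _)
  by_contra h
  exact hz (by simp [xdx, fderiv_of_notMem_tsupport (𝕜 := ℝ) h])

/-- `(x·∇)` preserves compact support. [folklore] -/
theorem hasCompactSupport_xdx (hV : HasCompactSupport V) : HasCompactSupport (xdx V) :=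
  hV.mono' ((subset_tsupport _).trans (tsupport_xdx_subset V))

/-- `tsupport ΔₓV ⊆ tsupport V`. [folklore] -/
theorem tsupport_lap_subset [FiniteDimensional ℝ E] (V : ℝ × E → F) :
    tsupport (lap V) ⊆ tsupport V := by
  refine closure_minimal (fun z hz => ?_) (isClosed_tsupport _)
  by_contra h
  refine hz ?_
  simp only [lap]
  refine Finset.sum_eq_zero fun i _ => ?_
  have h1 : z ∉ tsupport (dx (stdOrthonormalBasis ℝ E i) V) :=
    fun h' => h (tsupport_dx_subset _ V h')
  show fderiv ℝ (dx (stdOrthonormalBasis ℝ E i) V) z (0, stdOrthonormalBasis ℝ E i) = 0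
  rw [fderiv_of_notMem_tsupport (𝕜 := ℝ) h1]
  rfl

/-- `Δₓ` preserves compact support. [folklore] -/
theorem hasCompactSupport_lap [FiniteDimensional ℝ E] (hV : HasCompactSupport V) :
    HasCompactSupport (lap V) :=
  hV.mono' ((subset_tsupport _).trans (tsupport_lap_subset V))

/-! #### Schwarz: commuting directional derivatives -/

/-- A smooth field is `C²`. [folklore] -/
theorem contDiff_two_of_top (hV : ContDiff ℝ (⊤ : ℕ∞) V) : ContDiff ℝ 2 V :=
  hV.of_le (WithTop.coe_le_coe.2 le_top)

/-- `D(z ↦ DV(z) w)(z) w' = D²V(z) w' w` for `V ∈ C^∞`. [folklore] -/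
theorem fderiv_fderiv_apply_const (hV : ContDiff ℝ (⊤ : ℕ∞) V) (z w w' : ℝ × E) :
    fderiv ℝ (fun y => fderiv ℝ V y w) z w' = fderiv ℝ (fderiv ℝ V) z w' w := by
  have hd : DifferentiableAt ℝ (fderiv ℝ V) z :=
    (((contDiff_two_of_top hV).fderiv_right (m := 1) le_rfl).differentiable one_ne_zero) z
  rw [fderiv_clm_apply hd (differentiableAt_const w)]
  simp

/-- **Schwarz's rule** for the directional derivatives of a smooth space–time field:
`∂_w ∂_{w'} V = ∂_{w'} ∂_w V`. [folklore] -/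
theorem fderiv_apply_comm (hV : ContDiff ℝ (⊤ : ℕ∞) V) (z w w' : ℝ × E) :
    fderiv ℝ (fun y => fderiv ℝ V y w) z w' = fderiv ℝ (fun y => fderiv ℝ V y w') z w := by
  rw [fderiv_fderiv_apply_const hV, fderiv_fderiv_apply_const hV]
  exact ((contDiff_two_of_top hV).contDiffAt.isSymmSndFDerivAt (by simp)).eq w' w

/-- `∂ₑ∂ₜV = ∂ₜ∂ₑV`. [folklore] -/
theorem dx_dt_comm (hV : ContDiff ℝ (⊤ : ℕ∞) V) (e : E) (z : ℝ × E) :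
    dx e (dt V) z = dt (dx e V) z :=
  fderiv_apply_comm hV z _ _

/-- `∂ₑ((x·∇)V) = (x·∇)(∂ₑV) + ∂ₑV` (the dilation derivative has the affine coefficient `x`). [cite: Seregin2014, App. A.1 (A.1.6)] -/
theorem dx_xdx (hV : ContDiff ℝ (⊤ : ℕ∞) V) (e : E) (z : ℝ × E) :
    dx e (xdx V) z = xdx (dx e V) z + dx e V z := by
  have hd : DifferentiableAt ℝ (fderiv ℝ V) z :=
    (((contDiff_two_of_top hV).fderiv_right (m := 1) le_rfl).differentiable one_ne_zero) z
  have hc : DifferentiableAt ℝ (fun y : ℝ × E => ((0 : ℝ), y.2)) z :=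
    (differentiableAt_const _).prodMk differentiableAt_snd
  simp only [dx_apply, xdx_apply]
  rw [show (xdx V) = fun y => fderiv ℝ V y ((0 : ℝ), y.2) from rfl]
  rw [fderiv_clm_apply hd hc]
  simp only [_root_.add_apply, ContinuousLinearMap.comp_apply,
    ContinuousLinearMap.flip_apply]
  rw [DifferentiableAt.fderiv_prodMk (differentiableAt_const _) differentiableAt_snd]
  simp only [fderiv_fun_const, Pi.zero_apply, fderiv_snd, ContinuousLinearMap.prod_apply,
    ContinuousLinearMap.coe_snd']
  rw [((contDiff_two_of_top hV).contDiffAt.isSymmSndFDerivAt (by simp)).eq ((0 : ℝ), e)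
    ((0 : ℝ), z.2), ← fderiv_fderiv_apply_const hV]
  simp only [zero_apply]
  abel

end Operators


section Glue

variable {E : Type*} [NormedAddCommGroup E] [NormedSpace ℝ E]
variable {G : Type*} [NormedAddCommGroup G] [NormedSpace ℝ G]

omit [NormedSpace ℝ E] [NormedSpace ℝ G] in
/-- **Gluing across the initial layer.** A function on `ℝ × E` which vanishes for `t < δ` and is
continuous on `{t > δ/2}` is continuous (the two open sets cover). Used for integrands carrying
weights singular at `t = 0` against fields supported in `t ≥ δ`. [folklore] -/
theorem continuous_of_zero_of_lt {f : ℝ × E → G} {δ : ℝ} (hδ : 0 < δ)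
    (hf : ContinuousOn f {z | δ / 2 < z.1}) (h0 : ∀ z : ℝ × E, z.1 < δ → f z = 0) :
    Continuous f := by
  rw [continuous_iff_continuousAt]
  intro z
  by_cases hz : δ / 2 < z.1
  · exact hf.continuousAt ((isOpen_lt continuous_const continuous_fst).mem_nhds hz)
  · have hzδ : z.1 < δ := by linarith [not_lt.1 hz]
    have hev : f =ᶠ[𝓝 z] fun _ => 0 := by
      filter_upwards [(isOpen_lt continuous_fst continuous_const).mem_nhds hzδ] with y hy
      exact h0 y hy
    exact continuousAt_const.congr_of_eventuallyEq hev

/-- **Gluing across the initial layer, smooth version.** A function on `ℝ × E` vanishing for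
`t < δ` and `C^n` on `{t > δ/2}` is `C^n`. [folklore] -/
theorem contDiff_of_zero_of_lt {f : ℝ × E → G} {δ : ℝ} {n : WithTop ℕ∞} (hδ : 0 < δ)
    (hf : ContDiffOn ℝ n f {z | δ / 2 < z.1}) (h0 : ∀ z : ℝ × E, z.1 < δ → f z = 0) :
    ContDiff ℝ n f := by
  rw [contDiff_iff_contDiffAt]
  intro z
  by_cases hz : δ / 2 < z.1
  · exact hf.contDiffAt ((isOpen_lt continuous_const continuous_fst).mem_nhds hz)
  · have hzδ : z.1 < δ := by linarith [not_lt.1 hz]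
    have hev : f =ᶠ[𝓝 z] fun _ => 0 := by
      filter_upwards [(isOpen_lt continuous_fst continuous_const).mem_nhds hzδ] with y hy
      exact h0 y hy
    exact contDiffAt_const.congr_of_eventuallyEq hev

omit [NormedSpace ℝ E] [NormedSpace ℝ G] in
/-- Fields supported in `{t ≥ δ}` vanish identically for `t < δ`. [folklore] -/
theorem eq_zero_of_lt {V : ℝ × E → G} {δ : ℝ} (hV : tsupport V ⊆ {z | δ ≤ z.1})
    {z : ℝ × E} (hz : z.1 < δ) : V z = 0 :=
  image_eq_zero_of_notMem_tsupport fun h => (not_le.2 hz) (hV h)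

/-- Fields supported in `{t ≥ δ}` have vanishing derivative for `t < δ`. [folklore] -/
theorem fderiv_eq_zero_of_lt {V : ℝ × E → G} {δ : ℝ} (hV : tsupport V ⊆ {z | δ ≤ z.1})
    {z : ℝ × E} (hz : z.1 < δ) : fderiv ℝ V z = 0 :=
  fderiv_of_notMem_tsupport (𝕜 := ℝ) fun h => (not_le.2 hz) (hV h)

end Glue

section IBP

variable {E : Type*} [NormedAddCommGroup E] [InnerProductSpace ℝ E] [FiniteDimensional ℝ E]
  [MeasurableSpace E] [BorelSpace E]
variable {F : Type*} [NormedAddCommGroup F] [InnerProductSpace ℝ F]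

/-! #### Compactly supported continuous integrands -/

omit [InnerProductSpace ℝ E] [FiniteDimensional ℝ E] [MeasurableSpace E] [BorelSpace E] in
/-- A weighted pairing `w ⟪Φ, X⟫` is compactly supported when `Φ` is. [folklore] -/
theorem hasCompactSupport_mul_inner_left {w : ℝ × E → ℝ} {Φ X : ℝ × E → F}
    (hΦ : HasCompactSupport Φ) : HasCompactSupport fun z => w z * ⟪Φ z, X z⟫ :=
  hΦ.mono fun z hz => by
    contrapose! hz
    simp [notMem_support.1 hz]

omit [InnerProductSpace ℝ E] [FiniteDimensional ℝ E] [MeasurableSpace E] [BorelSpace E] in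
/-- A weighted pairing `w ⟪X, Ψ⟫` is compactly supported when `Ψ` is. [folklore] -/
theorem hasCompactSupport_mul_inner_right {w : ℝ × E → ℝ} {X Ψ : ℝ × E → F}
    (hΨ : HasCompactSupport Ψ) : HasCompactSupport fun z => w z * ⟪X z, Ψ z⟫ :=
  hΨ.mono fun z hz => by
    contrapose! hz
    simp [notMem_support.1 hz]

/-- Continuous compactly supported functions on `ℝ × E` are integrable. [folklore] -/
theorem integrable_of_continuous_hasCompactSupport {G : Type*} [NormedAddCommGroup G]
    {f : ℝ × E → G} (hf : Continuous f) (hfc : HasCompactSupport f) : Integrable f :=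
  hf.integrable_of_hasCompactSupport hfc

/-! #### Integration by parts on `ℝ × E` -/

omit [InnerProductSpace ℝ E] [FiniteDimensional ℝ E] [MeasurableSpace E] [BorelSpace E] in
/-- Pairings of a field supported in `{t ≥ δ}`: continuity follows from continuity on
`{t > δ/2}` of the other factors. [folklore] -/
theorem continuous_mul_inner_of_support {δ : ℝ} (hδ : 0 < δ) {g : ℝ × E → ℝ} {A B : ℝ × E → F}
    (hg : ContinuousOn g {z | δ / 2 < z.1}) (hA : ContinuousOn A {z | δ / 2 < z.1})
    (hB : ContinuousOn B {z | δ / 2 < z.1})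
    (h0 : ∀ z : ℝ × E, z.1 < δ → A z = 0 ∨ B z = 0) :
    Continuous fun z => g z * ⟪A z, B z⟫ := by
  refine continuous_of_zero_of_lt hδ (hg.mul ?_) fun z hz => ?_
  · exact continuous_inner.comp_continuousOn (hA.prodMk hB)
  · rcases h0 z hz with h | h <;> simp [h]

/-- **Integration by parts on space–time without boundary terms** (weighted inner-product
form): let `0 < δ`, let `w : ℝ × E → ℝ` be `C¹` on the open half-space `{t > δ/2}`, let
`Φ, Ψ : ℝ × E → F` be `C¹` and compactly supported with `Φ` supported in `{t ≥ δ}`. Then for any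
direction `v`,
`∫ w ⟪Φ, ∂ᵥΨ⟫ = -∫ ∂ᵥw ⟪Φ, Ψ⟫ - ∫ w ⟪∂ᵥΦ, Ψ⟫`
(Mathlib's `integral_bilinear_hasFDerivAt_right_eq_neg_left_of_integrable` for the pair
`(w • Φ, Ψ)` and the inner product, on the finite-dimensional space `ℝ × E` with its additive
Haar (Lebesgue) measure; `w • Φ` is `C¹` since it vanishes for `t < δ`, and all products are
continuous and compactly supported). The weight may be singular at `t = 0`. [folklore] -/
theorem integral_mul_inner_fderiv_eq {δ : ℝ} (hδ : 0 < δ) {w : ℝ × E → ℝ} {Φ Ψ : ℝ × E → F}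
    (hw : ContDiffOn ℝ 1 w {z | δ / 2 < z.1}) (hΦ : ContDiff ℝ 1 Φ) (hΨ : ContDiff ℝ 1 Ψ)
    (hΦc : HasCompactSupport Φ) (hΨc : HasCompactSupport Ψ)
    (hΦδ : tsupport Φ ⊆ {z | δ ≤ z.1}) (v : ℝ × E) :
    ∫ z, w z * ⟪Φ z, fderiv ℝ Ψ z v⟫ =
      -(∫ z, fderiv ℝ w z v * ⟪Φ z, Ψ z⟫) - ∫ z, w z * ⟪fderiv ℝ Φ z v, Ψ z⟫ := by
  haveI : (volume : Measure (ℝ × E)).IsAddHaarMeasure := Measure.prod.instIsAddHaarMeasure _ _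
  set U : Set (ℝ × E) := {z | δ / 2 < z.1} with hU
  have hUo : IsOpen U := isOpen_lt continuous_const continuous_fst
  -- continuity and differentiability of the data
  have cw : ContinuousOn w U := hw.continuousOn
  have cΦ : Continuous Φ := hΦ.continuous
  have cΨ : Continuous Ψ := hΨ.continuous
  have cdw : ContinuousOn (fun z => fderiv ℝ w z v) U :=
    (hw.continuousOn_fderiv_of_isOpen hUo le_rfl).clm_apply continuousOn_const
  have cdΦ : Continuous fun z => fderiv ℝ Φ z v :=
    (hΦ.continuous_fderiv one_ne_zero).clm_apply continuous_const
  have cdΨ : Continuous fun z => fderiv ℝ Ψ z v :=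
    (hΨ.continuous_fderiv one_ne_zero).clm_apply continuous_const
  have dw : ∀ z ∈ U, HasFDerivAt w (fderiv ℝ w z) z := fun z hz =>
    ((hw.differentiableOn one_ne_zero).differentiableAt (hUo.mem_nhds hz)).hasFDerivAt
  have dΦ : ∀ z, HasFDerivAt Φ (fderiv ℝ Φ z) z := fun z =>
    (hΦ.differentiable one_ne_zero z).hasFDerivAt
  have dΨ : ∀ z, HasFDerivAt Ψ (fderiv ℝ Ψ z) z := fun z =>
    (hΨ.differentiable one_ne_zero z).hasFDerivAt
  -- vanishing of `Φ`, `DΦ` in the initial layer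
  have hΦ0 : ∀ z : ℝ × E, z.1 < δ → Φ z = 0 := fun z hz => eq_zero_of_lt hΦδ hz
  have hdΦ0 : ∀ z : ℝ × E, z.1 < δ → fderiv ℝ Φ z = 0 := fun z hz => fderiv_eq_zero_of_lt hΦδ hz
  -- the pair `(w • Φ, Ψ)`
  set f : ℝ × E → F := fun z => w z • Φ z with hf
  set f' : ℝ × E → (ℝ × E →L[ℝ] F) := fun z =>
    w z • fderiv ℝ Φ z + (fderiv ℝ w z).smulRight (Φ z) with hf'
  have df : ∀ z, HasFDerivAt f (f' z) z := by
    intro z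
    by_cases hz : δ / 2 < z.1
    · exact (dw z hz).smul (dΦ z)
    · have hzδ : z.1 < δ := by linarith [not_lt.1 hz]
      have hev : f =ᶠ[𝓝 z] fun _ => 0 := by
        filter_upwards [(isOpen_lt continuous_fst continuous_const).mem_nhds hzδ] with y hy
        simp [hf, hΦ0 y hy]
      have h0 : f' z = 0 := by
        simp [hf', hΦ0 z hzδ, hdΦ0 z hzδ]
      rw [h0]
      exact (hasFDerivAt_const (0 : F) z).congr_of_eventuallyEq hev
  have hf'v : ∀ z, f' z v = w z • fderiv ℝ Φ z v + fderiv ℝ w z v • Φ z := fun z => by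
    simp [hf', add_comm]
  set B : F →L[ℝ] F →L[ℝ] ℝ := innerSL ℝ with hB
  have hBapp : ∀ a b : F, B a b = ⟪a, b⟫ := fun a b => rfl
  -- integrability of the three products
  have i1 : Integrable (fun z => B (f' z v) (Ψ z)) := by
    refine integrable_of_continuous_hasCompactSupport ?_ ?_
    · simp_rw [hBapp, hf'v]
      have := continuous_mul_inner_of_support hδ (g := fun _ => (1 : ℝ))
        (A := fun z => w z • fderiv ℝ Φ z v + fderiv ℝ w z v • Φ z) (B := Ψ) continuousOn_const
        ((cw.smul cdΦ.continuousOn).add (cdw.smul cΦ.continuousOn)) cΨ.continuousOn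
        (fun z hz => Or.inl (by simp [hΦ0 z hz, hdΦ0 z hz]))
      simpa using this
    · exact hΨc.mono fun z hz => by
        contrapose! hz
        simp [hBapp, notMem_support.1 hz]
  have i2 : Integrable (fun z => B (f z) (fderiv ℝ Ψ z v)) := by
    refine integrable_of_continuous_hasCompactSupport ?_ ?_
    · simp_rw [hBapp, hf]
      have := continuous_mul_inner_of_support hδ (g := fun _ => (1 : ℝ))
        (A := fun z => w z • Φ z) (B := fun z => fderiv ℝ Ψ z v) continuousOn_const
        (cw.smul cΦ.continuousOn) cdΨ.continuousOn
        (fun z hz => Or.inl (by simp [hΦ0 z hz]))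
      simpa using this
    · exact hΦc.mono fun z hz => by
        contrapose! hz
        simp [hBapp, hf, notMem_support.1 hz]
  have i3 : Integrable (fun z => B (f z) (Ψ z)) := by
    refine integrable_of_continuous_hasCompactSupport ?_ ?_
    · simp_rw [hBapp, hf]
      have := continuous_mul_inner_of_support hδ (g := fun _ => (1 : ℝ))
        (A := fun z => w z • Φ z) (B := Ψ) continuousOn_const
        (cw.smul cΦ.continuousOn) cΨ.continuousOn
        (fun z hz => Or.inl (by simp [hΦ0 z hz]))
      simpa using this
    · exact hΦc.mono fun z hz => by
        contrapose! hz
        simp [hBapp, hf, notMem_support.1 hz]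
  have key := integral_bilinear_hasFDerivAt_right_eq_neg_left_of_integrable (μ := volume)
    (B := B) i1 i2 i3 (fun z _ => df z) (fun z _ => dΨ z)
  -- rewrite both sides
  have lhs : ∫ z, B (f z) (fderiv ℝ Ψ z v) = ∫ z, w z * ⟪Φ z, fderiv ℝ Ψ z v⟫ :=
    integral_congr_ae (Eventually.of_forall fun z => by
      simp only [hBapp, hf, real_inner_smul_left])
  have j1 : Integrable (fun z => w z * ⟪fderiv ℝ Φ z v, Ψ z⟫) :=
    integrable_of_continuous_hasCompactSupport
      (continuous_mul_inner_of_support hδ cw cdΦ.continuousOn cΨ.continuousOn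
        (fun z hz => Or.inl (by simp [hdΦ0 z hz])))
      (hasCompactSupport_mul_inner_right hΨc)
  have j2 : Integrable (fun z => fderiv ℝ w z v * ⟪Φ z, Ψ z⟫) :=
    integrable_of_continuous_hasCompactSupport
      (continuous_mul_inner_of_support hδ cdw cΦ.continuousOn cΨ.continuousOn
        (fun z hz => Or.inl (hΦ0 z hz)))
      (hasCompactSupport_mul_inner_right hΨc)
  have rhs : ∫ z, B (f' z v) (Ψ z) =
      (∫ z, w z * ⟪fderiv ℝ Φ z v, Ψ z⟫) + ∫ z, fderiv ℝ w z v * ⟪Φ z, Ψ z⟫ := by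
    rw [← integral_add j1 j2]
    refine integral_congr_ae (Eventually.of_forall fun z => ?_)
    simp only [hBapp, hf'v, inner_add_left, real_inner_smul_left]
  rw [← lhs, key, rhs]
  ring

/-! #### Consequences: squares, the frame expansion of `(x·∇)`, dilation identity -/

omit [InnerProductSpace ℝ E] [FiniteDimensional ℝ E] [MeasurableSpace E] [BorelSpace E]
  [InnerProductSpace ℝ F] in
/-- A weighted square `g ‖W‖²` is compactly supported when `W` is. [folklore] -/
theorem hasCompactSupport_mul_norm_sq {g : ℝ × E → ℝ} {W : ℝ × E → F}
    (hW : HasCompactSupport W) : HasCompactSupport fun z => g z * ‖W z‖ ^ 2 :=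
  hW.mono fun z hz => by
    contrapose! hz
    simp [notMem_support.1 hz]

omit [InnerProductSpace ℝ E] [FiniteDimensional ℝ E] [MeasurableSpace E] [BorelSpace E]
  [InnerProductSpace ℝ F] in
/-- Weighted squares of a field supported in `{t ≥ δ}` are continuous when the weight is
continuous on `{t > δ/2}`. [folklore] -/
theorem continuous_mul_norm_sq_of_support {δ : ℝ} (hδ : 0 < δ) {g : ℝ × E → ℝ} {W : ℝ × E → F}
    (hg : ContinuousOn g {z | δ / 2 < z.1}) (hW : Continuous W)
    (hWδ : tsupport W ⊆ {z | δ ≤ z.1}) : Continuous fun z => g z * ‖W z‖ ^ 2 := by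
  refine continuous_of_zero_of_lt hδ (hg.mul (hW.norm.pow 2).continuousOn) fun z hz => ?_
  simp [eq_zero_of_lt hWδ hz]

/-- **Differentiating a square under the integral**: `2 ∫ w ⟪W, ∂ᵥW⟫ = -∫ ∂ᵥw ‖W‖²` for a
weight `w` of class `C¹` on `{t > δ/2}` and a `C¹` compactly supported field `W` supported in
`{t ≥ δ}`. [folklore] -/
theorem two_mul_integral_mul_inner_fderiv_self {δ : ℝ} (hδ : 0 < δ) {w : ℝ × E → ℝ}
    {W : ℝ × E → F} (hw : ContDiffOn ℝ 1 w {z | δ / 2 < z.1}) (hW : ContDiff ℝ 1 W)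
    (hWc : HasCompactSupport W) (hWδ : tsupport W ⊆ {z | δ ≤ z.1}) (v : ℝ × E) :
    2 * ∫ z, w z * ⟪W z, fderiv ℝ W z v⟫ = -∫ z, fderiv ℝ w z v * ‖W z‖ ^ 2 := by
  have h := integral_mul_inner_fderiv_eq hδ hw hW hW hWc hWc hWδ v
  have e : ∫ z, w z * ⟪fderiv ℝ W z v, W z⟫ = ∫ z, w z * ⟪W z, fderiv ℝ W z v⟫ :=
    integral_congr_ae (Eventually.of_forall fun z => by
      show w z * ⟪fderiv ℝ W z v, W z⟫ = w z * ⟪W z, fderiv ℝ W z v⟫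
      rw [real_inner_comm])
  have e2 : ∫ z, fderiv ℝ w z v * ⟪W z, W z⟫ = ∫ z, fderiv ℝ w z v * ‖W z‖ ^ 2 :=
    integral_congr_ae (Eventually.of_forall fun z => by
      show fderiv ℝ w z v * ⟪W z, W z⟫ = fderiv ℝ w z v * ‖W z‖ ^ 2
      rw [real_inner_self_eq_norm_sq])
  rw [e] at h
  linarith

omit [MeasurableSpace E] [BorelSpace E] in
/-- Frame expansion of a purely spatial vector: `(0, x) = Σⱼ ⟪x, bⱼ⟫ (0, bⱼ)`. [folklore] -/
theorem prod_zero_eq_sum (x : E) :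
    (((0 : ℝ), x) : ℝ × E) =
      ∑ j, ⟪x, stdOrthonormalBasis ℝ E j⟫ • (((0 : ℝ), stdOrthonormalBasis ℝ E j) : ℝ × E) := by
  set b := stdOrthonormalBasis ℝ E
  ext
  · simp [Prod.fst_sum]
  · simp only [Prod.snd_sum, Prod.smul_snd]
    conv_lhs => rw [← b.sum_repr' x]
    refine Finset.sum_congr rfl fun j _ => ?_
    rw [real_inner_comm]

omit [MeasurableSpace E] [BorelSpace E] in
/-- Frame expansion of the dilation derivative: `(x·∇)W = Σⱼ xⱼ ∂ⱼW`, `xⱼ = ⟪x, bⱼ⟫`. [folklore] -/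
theorem xdx_eq_sum {G : Type*} [NormedAddCommGroup G] [NormedSpace ℝ G] (W : ℝ × E → G)
    (z : ℝ × E) :
    xdx W z = ∑ j, ⟪z.2, stdOrthonormalBasis ℝ E j⟫ • dx (stdOrthonormalBasis ℝ E j) W z := by
  simp only [xdx_apply, dx_apply]
  rw [prod_zero_eq_sum z.2, map_sum]
  simp only [map_smul]

omit [MeasurableSpace E] [BorelSpace E] in
/-- Frame expansion of a derivative along a purely spatial vector:
`Dw(z)(0, x) = Σⱼ ⟪x, bⱼ⟫ Dw(z)(0, bⱼ)`. [folklore] -/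
theorem fderiv_apply_zero_eq_sum (w : ℝ × E → ℝ) (z : ℝ × E) (x : E) :
    fderiv ℝ w z (0, x) =
      ∑ j, ⟪x, stdOrthonormalBasis ℝ E j⟫ * fderiv ℝ w z (0, stdOrthonormalBasis ℝ E j) := by
  rw [prod_zero_eq_sum x, map_sum]
  simp only [map_smul, smul_eq_mul]

omit [MeasurableSpace E] [BorelSpace E] [FiniteDimensional ℝ E] in
/-- The coordinate weight `z ↦ ⟪x, c⟫` is smooth. [folklore] -/
theorem contDiff_inner_snd_const (c : E) {n : WithTop ℕ∞} :
    ContDiff ℝ n fun z : ℝ × E => ⟪z.2, c⟫ :=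
  contDiff_snd.inner ℝ contDiff_const

omit [MeasurableSpace E] [BorelSpace E] [FiniteDimensional ℝ E] in
/-- Derivative of the coordinate weight `⟪x, c⟫` along `v = (s, e)`: `⟪e, c⟫`. [folklore] -/
theorem fderiv_inner_snd_const (c : E) (z v : ℝ × E) :
    fderiv ℝ (fun y : ℝ × E => ⟪y.2, c⟫) z v = ⟪v.2, c⟫ := by
  have h : HasFDerivAt (fun y : ℝ × E => ⟪y.2, c⟫)
      ((innerSL ℝ c).comp (ContinuousLinearMap.snd ℝ ℝ E)) z := by
    have h1 : (fun y : ℝ × E => ⟪y.2, c⟫) =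
        fun y => ((innerSL ℝ c).comp (ContinuousLinearMap.snd ℝ ℝ E)) y := by
      funext y
      simp [real_inner_comm]
    rw [h1]
    exact ContinuousLinearMap.hasFDerivAt _
  rw [h.fderiv]
  simp [real_inner_comm]

omit [MeasurableSpace E] [BorelSpace E] [FiniteDimensional ℝ E] in
/-- Derivative of the time coordinate `z ↦ t` along `v`: `v.1`. [folklore] -/
theorem fderiv_fst_apply (z v : ℝ × E) :
    fderiv ℝ (fun y : ℝ × E => y.1) z v = v.1 := by
  rw [show (fun y : ℝ × E => y.1) = Prod.fst from rfl, fderiv_fst]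
  rfl

/-- **The dilation identity**: `2 ∫ w ⟪(x·∇)W, W⟫ = -∫ ((x·∇)w + n w) ‖W‖²`, `n = dim E`, for
a weight `w` of class `C¹` on `{t > δ/2}` and a `C¹` compactly supported field `W` supported in
`{t ≥ δ}` (sum over the frame of the square rule with the weights `w xⱼ`,
`∂ⱼ(w xⱼ) = xⱼ ∂ⱼw + w`). [cite: Seregin2014, App. A.1 (A.1.6)] -/
theorem two_mul_integral_mul_inner_xdx_self {δ : ℝ} (hδ : 0 < δ) {w : ℝ × E → ℝ}
    {W : ℝ × E → F} (hw : ContDiffOn ℝ 1 w {z | δ / 2 < z.1}) (hW : ContDiff ℝ 1 W)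
    (hWc : HasCompactSupport W) (hWδ : tsupport W ⊆ {z | δ ≤ z.1}) :
    2 * ∫ z, w z * ⟪xdx W z, W z⟫ =
      -∫ z, (fderiv ℝ w z (0, z.2) + Module.finrank ℝ E * w z) * ‖W z‖ ^ 2 := by
  set b := stdOrthonormalBasis ℝ E with hb
  set U : Set (ℝ × E) := {z | δ / 2 < z.1} with hU
  have hUo : IsOpen U := isOpen_lt continuous_const continuous_fst
  have cw : ContinuousOn w U := hw.continuousOn
  have cW : Continuous W := hW.continuous
  have cdw : ∀ v, ContinuousOn (fun z => fderiv ℝ w z v) U := fun v =>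
    (hw.continuousOn_fderiv_of_isOpen hUo le_rfl).clm_apply continuousOn_const
  have cdW : ∀ v, Continuous fun z => fderiv ℝ W z v := fun v =>
    (hW.continuous_fderiv one_ne_zero).clm_apply continuous_const
  have hW0 : ∀ z : ℝ × E, z.1 < δ → W z = 0 := fun z hz => eq_zero_of_lt hWδ hz
  -- the weights `w xⱼ` and their derivatives `∂ⱼ(w xⱼ) = xⱼ ∂ⱼw + w` on `U`
  have hwj : ∀ j, ContDiffOn ℝ 1 (fun z : ℝ × E => w z * ⟪z.2, b j⟫) U := fun j =>
    hw.mul (contDiff_inner_snd_const (b j)).contDiffOn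
  have hdwj : ∀ j, ∀ z ∈ U, fderiv ℝ (fun y : ℝ × E => w y * ⟪y.2, b j⟫) z (0, b j) =
      fderiv ℝ w z (0, b j) * ⟪z.2, b j⟫ + w z := by
    intro j z hz
    have hwd : DifferentiableAt ℝ w z :=
      (hw.differentiableOn one_ne_zero).differentiableAt (hUo.mem_nhds hz)
    rw [fderiv_fun_mul hwd ((contDiff_inner_snd_const (b j)).differentiable one_ne_zero z)]
    simp only [_root_.add_apply, _root_.smul_apply, smul_eq_mul,
      fderiv_inner_snd_const]
    rw [real_inner_self_eq_norm_sq, b.norm_eq_one, one_pow]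
    ring
  -- expand `(x·∇)W` in the frame and integrate term by term
  have hexp : ∀ z, w z * ⟪xdx W z, W z⟫ =
      ∑ j, (w z * ⟪z.2, b j⟫) * ⟪W z, fderiv ℝ W z (0, b j)⟫ := by
    intro z
    rw [xdx_eq_sum, sum_inner, Finset.mul_sum]
    refine Finset.sum_congr rfl fun j _ => ?_
    rw [real_inner_smul_left, dx_apply, real_inner_comm (W z)]
    ring
  have hint : ∀ j, Integrable fun z => (w z * ⟪z.2, b j⟫) * ⟪W z, fderiv ℝ W z (0, b j)⟫ :=
    fun j => integrable_of_continuous_hasCompactSupport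
      (continuous_mul_inner_of_support hδ (cw.mul (continuous_snd.inner continuous_const).continuousOn)
        cW.continuousOn (cdW _).continuousOn fun z hz => Or.inl (hW0 z hz))
      (hasCompactSupport_mul_inner_left hWc)
  have hint2 : ∀ j, Integrable fun z =>
      (fderiv ℝ w z (0, b j) * ⟪z.2, b j⟫ + w z) * ‖W z‖ ^ 2 := fun j =>
    integrable_of_continuous_hasCompactSupport
      (continuous_mul_norm_sq_of_support hδ
        (((cdw _).mul (continuous_snd.inner continuous_const).continuousOn).add cw) cW hWδ)
      (hasCompactSupport_mul_norm_sq hWc)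
  have step1 : ∫ z, w z * ⟪xdx W z, W z⟫ =
      ∑ j, ∫ z, (w z * ⟪z.2, b j⟫) * ⟪W z, fderiv ℝ W z (0, b j)⟫ := by
    rw [← integral_finsetSum _ fun j _ => hint j]
    exact integral_congr_ae (Eventually.of_forall hexp)
  have step2 : ∀ j, 2 * ∫ z, (w z * ⟪z.2, b j⟫) * ⟪W z, fderiv ℝ W z (0, b j)⟫ =
      -∫ z, (fderiv ℝ w z (0, b j) * ⟪z.2, b j⟫ + w z) * ‖W z‖ ^ 2 := by
    intro j
    rw [two_mul_integral_mul_inner_fderiv_self hδ (hwj j) hW hWc hWδ (0, b j)]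
    congr 1
    refine integral_congr_ae (Eventually.of_forall fun z => ?_)
    by_cases hz : δ / 2 < z.1
    · simp only [hdwj j z hz]
    · have : W z = 0 := hW0 z (by linarith [not_lt.1 hz])
      simp [this]
  -- the pointwise sum of the frame weights
  have hsum : ∀ z, ∑ j, (fderiv ℝ w z (0, b j) * ⟪z.2, b j⟫ + w z) * ‖W z‖ ^ 2 =
      (fderiv ℝ w z (0, z.2) + Module.finrank ℝ E * w z) * ‖W z‖ ^ 2 := by
    intro z
    rw [← Finset.sum_mul, Finset.sum_add_distrib, Finset.sum_const, Finset.card_univ,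
      Fintype.card_fin, nsmul_eq_mul, fderiv_apply_zero_eq_sum w z z.2]
    congr 2
    exact Finset.sum_congr rfl fun j _ => mul_comm _ _
  calc 2 * ∫ z, w z * ⟪xdx W z, W z⟫
      = ∑ j, 2 * ∫ z, (w z * ⟪z.2, b j⟫) * ⟪W z, fderiv ℝ W z (0, b j)⟫ := by
        rw [step1, Finset.mul_sum]
    _ = ∑ j, -∫ z, (fderiv ℝ w z (0, b j) * ⟪z.2, b j⟫ + w z) * ‖W z‖ ^ 2 :=
        Finset.sum_congr rfl fun j _ => step2 j
    _ = -∫ z, ∑ j, (fderiv ℝ w z (0, b j) * ⟪z.2, b j⟫ + w z) * ‖W z‖ ^ 2 := by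
        rw [Finset.sum_neg_distrib, integral_finsetSum _ fun j _ => hint2 j]
    _ = -∫ z, (fderiv ℝ w z (0, z.2) + Module.finrank ℝ E * w z) * ‖W z‖ ^ 2 := by
        congr 1
        exact integral_congr_ae (Eventually.of_forall hsum)

end IBP



section TimeWeights

variable {E : Type*} [NormedAddCommGroup E] [InnerProductSpace ℝ E] [FiniteDimensional ℝ E]
  [MeasurableSpace E] [BorelSpace E]
variable {F : Type*} [NormedAddCommGroup F] [InnerProductSpace ℝ F]
variable {δ : ℝ} {g : ℝ → ℝ} {V : ℝ × E → F}

omit [MeasurableSpace E] [BorelSpace E] [FiniteDimensional ℝ E] in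
/-- A time-only weight `z ↦ g(t)` is as smooth as `g`. [folklore] -/
theorem contDiff_comp_fst {n : WithTop ℕ∞} (hg : ContDiff ℝ n g) :
    ContDiff ℝ n fun z : ℝ × E => g z.1 :=
  hg.comp contDiff_fst

omit [MeasurableSpace E] [BorelSpace E] [FiniteDimensional ℝ E] in
/-- Derivative of a time-only weight: `D(g ∘ t)(z) v = g'(t) v.1`; in particular it vanishes
along spatial directions. [folklore] -/
theorem fderiv_comp_fst_apply (hg : ContDiff ℝ 1 g) (z v : ℝ × E) :
    fderiv ℝ (fun y : ℝ × E => g y.1) z v = deriv g z.1 * v.1 := by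
  have hgd : DifferentiableAt ℝ g z.1 := hg.differentiable one_ne_zero z.1
  have h : HasFDerivAt (fun y : ℝ × E => g y.1)
      (((1 : ℝ →L[ℝ] ℝ).smulRight (deriv g z.1)).comp (ContinuousLinearMap.fst ℝ ℝ E)) z :=
    hgd.hasDerivAt.hasFDerivAt.comp z hasFDerivAt_fst
  rw [h.fderiv]
  simp [mul_comm]

variable (hδ : 0 < δ) (hV : ContDiff ℝ (⊤ : ℕ∞) V) (hVc : HasCompactSupport V)
  (hVδ : tsupport V ⊆ {z | δ ≤ z.1})
include hδ hV hVc hVδ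

omit hVδ in
/-- **Green's formula in space**: `∫ g(t) ⟪X, ΔₓV⟫ = -Σᵢ ∫ g(t) ⟪∂ᵢX, ∂ᵢV⟫` for a `C¹` time
weight `g`, a `C¹` compactly supported field `X` supported in `{t ≥ δ}`, and `V` smooth
compactly supported. [folklore] -/
theorem integral_mul_inner_lap (hg : ContDiff ℝ 1 g) {X : ℝ × E → F} (hX : ContDiff ℝ 1 X)
    (hXc : HasCompactSupport X) (hXδ : tsupport X ⊆ {z | δ ≤ z.1}) :
    ∫ z, g z.1 * ⟪X z, lap V z⟫ =
      -∑ i, ∫ z, g z.1 * ⟪dx (stdOrthonormalBasis ℝ E i) X z,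
        dx (stdOrthonormalBasis ℝ E i) V z⟫ := by
  set b := stdOrthonormalBasis ℝ E with hb
  have hw : ContDiffOn ℝ 1 (fun z : ℝ × E => g z.1) {z | δ / 2 < z.1} :=
    (contDiff_comp_fst hg).contDiffOn
  have hV1 : ContDiff ℝ 1 V := hV.of_le (by exact_mod_cast le_top)
  have hdV1 : ∀ i, ContDiff ℝ 1 (dx (b i) V) := fun i =>
    (contDiff_dx hV (b i)).of_le (by exact_mod_cast le_top)
  -- per coordinate
  have step : ∀ i, ∫ z, g z.1 * ⟪X z, dx (b i) (dx (b i) V) z⟫ =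
      -∫ z, g z.1 * ⟪dx (b i) X z, dx (b i) V z⟫ := by
    intro i
    have h := integral_mul_inner_fderiv_eq hδ hw hX (hdV1 i) hXc (hasCompactSupport_dx hVc _)
      hXδ (0, b i)
    simp only [fderiv_comp_fst_apply hg, mul_zero, zero_mul, integral_zero, neg_zero,
      zero_sub] at h
    simpa only [dx_apply] using h
  -- sum
  have hint : ∀ i, Integrable fun z => g z.1 * ⟪X z, dx (b i) (dx (b i) V) z⟫ := fun i =>
    integrable_of_continuous_hasCompactSupport
      (continuous_mul_inner_of_support hδ (contDiff_comp_fst hg).continuous.continuousOn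
        hX.continuous.continuousOn (contDiff_dx (contDiff_dx hV _) _).continuous.continuousOn
        fun z hz => Or.inl (eq_zero_of_lt hXδ hz))
      (hasCompactSupport_mul_inner_left hXc)
  calc ∫ z, g z.1 * ⟪X z, lap V z⟫
      = ∫ z, ∑ i, g z.1 * ⟪X z, dx (b i) (dx (b i) V) z⟫ := by
        refine integral_congr_ae (Eventually.of_forall fun z => ?_)
        show g z.1 * ⟪X z, lap V z⟫ = ∑ i, g z.1 * ⟪X z, dx (b i) (dx (b i) V) z⟫
        rw [lap, ← Finset.mul_sum, ← inner_sum]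
    _ = ∑ i, ∫ z, g z.1 * ⟪X z, dx (b i) (dx (b i) V) z⟫ := integral_finsetSum _ fun i _ => hint i
    _ = ∑ i, -∫ z, g z.1 * ⟪dx (b i) X z, dx (b i) V z⟫ := Finset.sum_congr rfl fun i _ => step i
    _ = -∑ i, ∫ z, g z.1 * ⟪dx (b i) X z, dx (b i) V z⟫ := by rw [Finset.sum_neg_distrib]

/-- `∫ g(t) ⟪V, ΔₓV⟫ = -∫ g(t) |∇ₓV|²`. [folklore] -/
theorem integral_mul_inner_lap_self (hg : ContDiff ℝ 1 g) :
    ∫ z, g z.1 * ⟪V z, lap V z⟫ = -∫ z, g z.1 * gradSq V z := by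
  set b := stdOrthonormalBasis ℝ E with hb
  have hV1 : ContDiff ℝ 1 V := hV.of_le (by exact_mod_cast le_top)
  rw [integral_mul_inner_lap hδ hV hVc hg hV1 hVc hVδ]
  have hint : ∀ i, Integrable fun z => g z.1 * ‖dx (b i) V z‖ ^ 2 := fun i =>
    integrable_of_continuous_hasCompactSupport
      (continuous_mul_norm_sq_of_support hδ (contDiff_comp_fst hg).continuous.continuousOn
        (contDiff_dx hV _).continuous ((tsupport_dx_subset _ V).trans hVδ))
      (hasCompactSupport_mul_norm_sq (hasCompactSupport_dx hVc _))
  rw [show (fun z => g z.1 * gradSq V z) = fun z => ∑ i, g z.1 * ‖dx (b i) V z‖ ^ 2 from by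
    funext z; rw [gradSq, Finset.mul_sum], integral_finsetSum _ fun i _ => hint i]
  congr 1
  refine Finset.sum_congr rfl fun i _ => integral_congr_ae (Eventually.of_forall fun z => ?_)
  show g z.1 * ⟪dx (b i) V z, dx (b i) V z⟫ = g z.1 * ‖dx (b i) V z‖ ^ 2
  rw [real_inner_self_eq_norm_sq]

omit hV hVc hVδ in
/-- **Square rule with a time weight**: `2 ∫ g(t) ⟪W, ∂ₜW⟫ = -∫ g'(t) ‖W‖²` for a `C¹`
compactly supported `W` supported in `{t ≥ δ}`. [folklore] -/
theorem two_mul_integral_mul_inner_dt_self (hg : ContDiff ℝ 1 g) {W : ℝ × E → F}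
    (hW : ContDiff ℝ 1 W) (hWc : HasCompactSupport W) (hWδ : tsupport W ⊆ {z | δ ≤ z.1}) :
    2 * ∫ z, g z.1 * ⟪W z, dt W z⟫ = -∫ z, deriv g z.1 * ‖W z‖ ^ 2 := by
  have h := two_mul_integral_mul_inner_fderiv_self hδ (contDiff_comp_fst hg).contDiffOn hW hWc
    hWδ (1, 0)
  simp only [fderiv_comp_fst_apply hg, mul_one] at h
  simpa only [dt_apply] using h

omit hV hVc hVδ in
/-- **Dilation identity with a time weight**: `2 ∫ g(t) ⟪(x·∇)W, W⟫ = -n ∫ g(t) ‖W‖²`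
(`n = dim E`). [cite: Seregin2014, App. A.1 (A.1.6)] -/
theorem two_mul_integral_mul_inner_xdx_self' (hg : ContDiff ℝ 1 g) {W : ℝ × E → F}
    (hW : ContDiff ℝ 1 W) (hWc : HasCompactSupport W) (hWδ : tsupport W ⊆ {z | δ ≤ z.1}) :
    2 * ∫ z, g z.1 * ⟪xdx W z, W z⟫ = -(Module.finrank ℝ E * ∫ z, g z.1 * ‖W z‖ ^ 2) := by
  have h := two_mul_integral_mul_inner_xdx_self hδ (contDiff_comp_fst hg).contDiffOn hW hWc hWδ
  simp only [fderiv_comp_fst_apply hg, mul_zero, zero_add] at h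
  rw [h, ← integral_const_mul]
  congr 1
  refine integral_congr_ae (Eventually.of_forall fun z => ?_)
  show (Module.finrank ℝ E : ℝ) * g z.1 * ‖W z‖ ^ 2 = Module.finrank ℝ E * (g z.1 * ‖W z‖ ^ 2)
  ring

/-- `∫ g(t) ⟪∂ₜV, ΔₓV⟫ = ½ ∫ g'(t) |∇ₓV|²` (Green in space, Schwarz, and the square rule in
time). [cite: Seregin2014, App. A.1 (A.1.6)] -/
theorem integral_mul_inner_dt_lap (hg : ContDiff ℝ 1 g) :
    ∫ z, g z.1 * ⟪dt V z, lap V z⟫ = (1 / 2) * ∫ z, deriv g z.1 * gradSq V z := by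
  set b := stdOrthonormalBasis ℝ E with hb
  have hdt1 : ContDiff ℝ 1 (dt V) := (contDiff_dt hV).of_le (by exact_mod_cast le_top)
  have hdx1 : ∀ i, ContDiff ℝ 1 (dx (b i) V) := fun i =>
    (contDiff_dx hV (b i)).of_le (by exact_mod_cast le_top)
  have hdtδ : tsupport (dt V) ⊆ {z | δ ≤ z.1} := (tsupport_dt_subset V).trans hVδ
  have hdxδ : ∀ i, tsupport (dx (b i) V) ⊆ {z | δ ≤ z.1} := fun i =>
    (tsupport_dx_subset _ V).trans hVδ
  rw [integral_mul_inner_lap hδ hV hVc hg hdt1 (hasCompactSupport_dt hVc) hdtδ]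
  -- per coordinate: `∫ g ⟪∂ᵢ∂ₜV, ∂ᵢV⟫ = ∫ g ⟪∂ᵢV, ∂ₜ∂ᵢV⟫ = -½ ∫ g' ‖∂ᵢV‖²`
  have step : ∀ i, ∫ z, g z.1 * ⟪dx (b i) (dt V) z, dx (b i) V z⟫ =
      -(1 / 2) * ∫ z, deriv g z.1 * ‖dx (b i) V z‖ ^ 2 := by
    intro i
    have h := two_mul_integral_mul_inner_dt_self hδ hg (hdx1 i) (hasCompactSupport_dx hVc _) (hdxδ i)
    have e : ∫ z, g z.1 * ⟪dx (b i) (dt V) z, dx (b i) V z⟫ =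
        ∫ z, g z.1 * ⟪dx (b i) V z, dt (dx (b i) V) z⟫ :=
      integral_congr_ae (Eventually.of_forall fun z => by
        show g z.1 * ⟪dx (b i) (dt V) z, dx (b i) V z⟫ = g z.1 * ⟪dx (b i) V z, dt (dx (b i) V) z⟫
        rw [dx_dt_comm hV, real_inner_comm])
    rw [e]
    linarith
  have hint : ∀ i, Integrable fun z => deriv g z.1 * ‖dx (b i) V z‖ ^ 2 := fun i =>
    integrable_of_continuous_hasCompactSupport
      (continuous_mul_norm_sq_of_support hδ
        ((hg.continuous_deriv le_rfl).comp continuous_fst).continuousOn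
        (contDiff_dx hV _).continuous (hdxδ i))
      (hasCompactSupport_mul_norm_sq (hasCompactSupport_dx hVc _))
  rw [Finset.sum_congr rfl fun i _ => step i, ← Finset.mul_sum,
    ← integral_finsetSum _ fun i _ => hint i]
  rw [show (fun z => deriv g z.1 * gradSq V z) = fun z => ∑ i, deriv g z.1 * ‖dx (b i) V z‖ ^ 2
    from by funext z; rw [gradSq, Finset.mul_sum]]
  ring

/-- `∫ g(t) ⟪(x·∇)V, ΔₓV⟫ = (n/2 - 1) ∫ g(t) |∇ₓV|²` (Green in space,
`∂ᵢ(x·∇) = (x·∇)∂ᵢ + ∂ᵢ`, and the dilation identity). [cite: Seregin2014, App. A.1 (A.1.6)] -/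
theorem integral_mul_inner_xdx_lap (hg : ContDiff ℝ 1 g) :
    ∫ z, g z.1 * ⟪xdx V z, lap V z⟫ =
      (Module.finrank ℝ E / 2 - 1) * ∫ z, g z.1 * gradSq V z := by
  set b := stdOrthonormalBasis ℝ E with hb
  set n : ℝ := (Module.finrank ℝ E : ℝ) with hn
  have hx1 : ContDiff ℝ 1 (xdx V) := (contDiff_xdx hV).of_le (by exact_mod_cast le_top)
  have hdx1 : ∀ i, ContDiff ℝ 1 (dx (b i) V) := fun i =>
    (contDiff_dx hV (b i)).of_le (by exact_mod_cast le_top)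
  have hxδ : tsupport (xdx V) ⊆ {z | δ ≤ z.1} := (tsupport_xdx_subset V).trans hVδ
  have hdxδ : ∀ i, tsupport (dx (b i) V) ⊆ {z | δ ≤ z.1} := fun i =>
    (tsupport_dx_subset _ V).trans hVδ
  rw [integral_mul_inner_lap hδ hV hVc hg hx1 (hasCompactSupport_xdx hVc) hxδ]
  have hint1 : ∀ i, Integrable fun z => g z.1 * ⟪xdx (dx (b i) V) z, dx (b i) V z⟫ := fun i =>
    integrable_of_continuous_hasCompactSupport
      (continuous_mul_inner_of_support hδ (contDiff_comp_fst hg).continuous.continuousOn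
        (contDiff_xdx (contDiff_dx hV _)).continuous.continuousOn
        (contDiff_dx hV _).continuous.continuousOn
        fun z hz => Or.inr (eq_zero_of_lt (hdxδ i) hz))
      (hasCompactSupport_mul_inner_right (hasCompactSupport_dx hVc _))
  have hint2 : ∀ i, Integrable fun z => g z.1 * ‖dx (b i) V z‖ ^ 2 := fun i =>
    integrable_of_continuous_hasCompactSupport
      (continuous_mul_norm_sq_of_support hδ (contDiff_comp_fst hg).continuous.continuousOn
        (contDiff_dx hV _).continuous (hdxδ i))
      (hasCompactSupport_mul_norm_sq (hasCompactSupport_dx hVc _))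
  -- per coordinate
  have step : ∀ i, ∫ z, g z.1 * ⟪dx (b i) (xdx V) z, dx (b i) V z⟫ =
      (1 - n / 2) * ∫ z, g z.1 * ‖dx (b i) V z‖ ^ 2 := by
    intro i
    have hdil := two_mul_integral_mul_inner_xdx_self' hδ hg (hdx1 i) (hasCompactSupport_dx hVc _)
      (hdxδ i)
    have e : ∫ z, g z.1 * ⟪dx (b i) (xdx V) z, dx (b i) V z⟫ =
        (∫ z, g z.1 * ⟪xdx (dx (b i) V) z, dx (b i) V z⟫) + ∫ z, g z.1 * ‖dx (b i) V z‖ ^ 2 := by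
      rw [← integral_add (hint1 i) (hint2 i)]
      refine integral_congr_ae (Eventually.of_forall fun z => ?_)
      show g z.1 * ⟪dx (b i) (xdx V) z, dx (b i) V z⟫ =
        g z.1 * ⟪xdx (dx (b i) V) z, dx (b i) V z⟫ + g z.1 * ‖dx (b i) V z‖ ^ 2
      rw [dx_xdx hV, inner_add_left, real_inner_self_eq_norm_sq]
      ring
    rw [e]
    linarith
  rw [Finset.sum_congr rfl fun i _ => step i, ← Finset.mul_sum,
    ← integral_finsetSum _ fun i _ => hint2 i]
  rw [show (fun z => g z.1 * gradSq V z) = fun z => ∑ i, g z.1 * ‖dx (b i) V z‖ ^ 2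
    from by funext z; rw [gradSq, Finset.mul_sum]]
  ring

end TimeWeights

end Carleman

end Literature.Analysis.FluidPDE
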